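import Summits.QuantumFields.BalabanUV.T4Continuum.Support.NE7EtaBackgroundReferenceWitness
import Summits.QuantumFields.BalabanUV.T4Continuum.Support.TermwiseResidualWitnessTower
import HarnessLib

/-!
# NE7EtaBackgroundFamilyDocking — route #1 of the NE7 crux, stub S7 (NODE O, the BACKGROUND COORDINATE) × leaf S.5: node U3's
# rate along the tower for a `t`-INDEXED FAMILY of step functionals with ONE `t`-UNIFORM constant from `hclose`, and the END's
# residual-witness rate binders (W-rate-0)∕(W-rate-t) + (F′) PRODUCED on `occCarriers` from ONE selection

Cell `pub-balaban`, rung (B)+1 sub-cell t4, lineage `b2b-balaban-t4-ne7-p1`, generation 55 (CRUX PROVER NE7 #1, ruling e34b3e0c (2)); crux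
skeleton `t4/skeletons/NE7-CRUX-R1.md` v1.7.14 §2 (stubs S5∕S7, NODE T) and record `t4/T4-EST-NE7-P1.md` §25 (leaf S.5).  HONEST FRAMING (page
1): FIXED FINITE T⁴, rung (B)+1; NE7, NE3 NOT PRINTED in [Balaban1984PropagatorsI]–[Balaban1989LargeFieldII] and NOT PROVED here; continuum YM
on T⁴ ⇐ BetaPertH ∧ nine spine estimates (0/9 proved); BetaPertH ⇐ (D1) ∧ (D4) ∧ CAP+tail; G-an2-4 gates asym, D1 and NE2/3/4; NOT infinite
volume, NOT mass gap, NOT Clay.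

WHAT ([folklore]; 0 def; 0 sorry).  Gen 19's `TermwiseResidualWitnessTower.wRates_of_uRateUpTo_family` PRODUCES the END's three residual-witness
rate binders (W-rate-t), (W-rate-0) (term ledger), (W-rate-0) (reference ledger) of
`TermwiseLocalThm1LedgerW.goodClause_summable_UN_levels_of_thm1At_residualW` from TWO inputs: `hURt : ∀ K t, |t| ≤ l₀ → URateUpTo K (EAᵗ) (EBᵗ)
(gA K) (gB K) (uA K) (uB K) Adm Cr θ′ κ` — node T's tower for the `t`-FAMILY with ONE constant `Cr` — and the END's (F′) `hwit`.  Its docstring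
books the producer of `hURt` as «`uRateUpTo_of_nodes` per `t`»; but `T4TowerRateDischarge.uRateUpTo_of_nodes` returns `∃ a` PER CALL, so a per-`t`
application yields `t`-DEPENDENT constants `a_t` and no single `Cr` (a located gap, small: the `a` of `argBracket_tower` depends only on the
Lipschitz-growth data `CU`, `P`, `q`, the closeness `C₃θ₃^K` and the rates — NOT on the functionals).  THIS FILE:
 * §1 **`uRateUpTo_of_hclose_family`** (ANY carrier): node U3's shapes for every member `|t| ≤ l₀` with `t`-UNIFORM data (`NE9 (EAᵗ) W κ Λ`,
   `LipBackground (EAᵗ) W κ CU`, `NE5 (EAᵗ) (EBᵗ) W κ θ₅ C₅`; one `FadingMemory C₉ ω Λ`, one `PolyLipGrowth CU g P q`) + `hclose` for the selections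
   + node U2's `InjectedRate` ⟹ ONE `a ≥ 0` with `URateUpTo K (EAᵗ) (EBᵗ) … (a + C₉(γ³Cd)θ′∕(θ′ − max(ω,θc)) + C₅) θ′ κ` for EVERY cutoff AND EVERY
   `|t| ≤ l₀` (`argBracket_tower` called ONCE, `uRateUpTo_tower_anyRate` per member) — literally the `hURt` of `wRates_of_uRateUpTo_family`;
   `cr_nonneg` — its constant is `≥ 0` (`C₉ ≥ 0` from `FadingMemory` at `k = i = 0`).
 * §2 **`uRateUpTo_family_hwit_occCarriers_of_hmin_ref`** — on NODE O's carrier `occCarriers`, from the gen-55 minimal bill (NE3's covariant root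
   amendment 4 with ANY real constants, NE3's (H∃) `hmin`, closed-form numerics, `hdom`, sector condition, reference datum `v₁ ∈ dom`):
   selections + reference backgrounds + ONE `a` with `hURt` (all `K`, all `|t| ≤ l₀`) AND the END's `hwit`, from ONE selection
   (`NE7EtaBackgroundReferenceWitness.hwit_of_hmin_ref` ∘ §1).
 * §3 **`wRates_hwit_occCarriers_of_hmin_ref`** — the END's (W-rate-t), (W-rate-0) ×2 (VERBATIM the conclusion of `wRates_of_uRateUpTo_family`, for
   `vc· K t X := E·ᵗ (g· K) one· X`, `CrW := 2·Cr`) AND (F′) `hwit`, on `occCarriers`, from the same hypotheses + the ledgers' scale bounds (W-sc).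
CONSEQUENCE.  Of the END's input list, the background-side binders `hUR` (l.92), `hwit` (l.132) and — for the `t`-dressed E-family of the
residual-proper factor — `hWratet` ∕ `hWrate0` ∕ `hWrate0'` are now PRODUCED on NODE O's carrier by name from: the bill of the background
coordinate + node U3's shapes (per member, `t`-uniform data) + node U2's `InjectedRate` + the ledgers' scale bounds.  Nothing in the ask of NE3
changes; route 1 stays KERNEL-COMPLETE AT FORM LEVEL ∕ DEPENDENT; NE7 NOT proved.  HONEST: composition of landed modules; every analytic input
(NE3's root, (H∃), NE5∕NE9∕the Lipschitz bracket for the `t`-family, node U2's rate) is a HYPOTHESIS; `EAᵗ`, `EBᵗ` are ABSTRACT (NODE O's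
functional half, X-A2); nothing of [I]–[III] asserted, instantiated or discharged.
-/

set_option autoImplicit false

open scoped BigOperators Matrix Matrix.Norms.L2Operator
open Finset NormedSpace

namespace Summit.QuantumFields.BalabanUV.T4Continuum.NE7EtaBackgroundFamilyDocking

open Literature.MathematicalPhysics.QuantumFieldTheory.Balaban1983to89
open B7Prop1Explicit B7Prop2Explicit
open T4AveragingDeficitWall hiding Site Plane Plaq Bond
open T4AveragingDeficitWallBoundary (periodBox IsPeriodicCfg)
open MinimalActionSandwich (IsMinimiser)
open MinimalActionRate (Regular sfClass)
open MinimalActionRefine (RegularSup gradConst)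
open T4OutputRate (Carriers Functional NE9 NE5 LipBackground FadingMemory)
open T4TowerRateComposition (PolyLipGrowth URateUpTo argBracket_tower couplingRate_pair_of_injectedDisc)
open T4TowerRateDischarge (uRateUpTo_tower_anyRate box_nonneg)
open T4CauchySum (InjectedRate)
open AveragingDeficitPeriodicCounting (IsPeriodicDir)
open AveragingDeficitTwoLevelPrep (twoLevelSmall)
open NE3EnergyShapes (residualScale IsUnitarySite IsPeriodicSite)
open NE3EnergyWeightedShapes (energyNormW)
open NE7EtaBackgroundCarrier
open TorusSmallFieldGlobalGauge (sectorConst)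
open NE7EtaBackgroundReferenceWitness (hwit_of_hmin_ref)
open TermwiseResidualWitness (wRates_of_uRateUpTo_family)

noncomputable section

/-! ## §1 Node U3 along the tower for a `t`-family, ONE constant (any carrier) -/

section AnyCarrier

variable {Car : Carriers} {ι : Type*}

/-- **NODE U3's RATE ALONG THE TOWER FOR A `t`-INDEXED FAMILY, WITH ONE `t`-UNIFORM CONSTANT** — the `hURt` input of
`TermwiseResidualWitnessTower.wRates_of_uRateUpTo_family`: node U3's shapes for every member `|t| ≤ l₀` with `t`-uniform data, the closeness
`hclose` of the selections (`C₃θ₃^K`), node U2's `InjectedRate` on the printed box, both runs' tables in `W`, ANY common rate `θ′` ⟹ ONE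
`a ≥ 0` serving every cutoff and every member (`argBracket_tower` depends on `CU`, `P`, `q`, `C₃`, `θ₃`, `θ′` only). [folklore] -/
theorem uRateUpTo_of_hclose_family {W : Set (ℕ → ℝ)} {EAt : ℝ → Functional Car Car.BgA} {EBt : ℝ → Functional Car Car.BgB}
    {κ θ₅ C₅ C₉ ω θc Cd γ C₃ θ₃ P θ' l₀ : ℝ} {q : ℕ} {Λ : ℕ → ℕ → ℝ} {CU : (ℕ → ℝ) → ℕ → ℝ} {g : ℕ → ℕ → ℝ}
    {uA : ℕ → ι → Car.BgA} {uB : ℕ → ι → Car.BgB} {dom : Set ι}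
    (h9 : ∀ t : ℝ, |t| ≤ l₀ → NE9 (EAt t) W κ Λ) (hΛ : FadingMemory C₉ ω Λ) (hω : 0 ≤ ω)
    (hU : ∀ t : ℝ, |t| ≤ l₀ → LipBackground (EAt t) W κ CU) (hG : PolyLipGrowth CU g P q) (hP : 0 ≤ P)
    (h5 : ∀ t : ℝ, |t| ≤ l₀ → NE5 (EAt t) (EBt t) W κ θ₅ C₅) (hθ₅ : 0 ≤ θ₅) (hC₅ : 0 ≤ C₅)
    (hclose : ∀ K : ℕ, ∀ v ∈ dom, Car.gauge (uA K v) (Car.transport (uB K v)) ≤ C₃ * θ₃ ^ K)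
    (hC₃ : 0 ≤ C₃) (hθ₃ : 0 ≤ θ₃) (hθ₃1 : θ₃ < 1)
    (hinj : InjectedRate Cd 0 θc (fun K j => T4CouplingMatching.disc (g K) (g (K + 1)) j)) (hCd : 0 ≤ Cd)
    (hθc : 0 ≤ θc) (hbox : ∀ K i, i ≤ K → 0 < g K i ∧ g K i ≤ γ)
    (hgA : ∀ K, g K ∈ W) (hgB : ∀ K, (fun i => g (K + 1) (i + 1)) ∈ W)
    (hθ' : max ω θc < θ') (hθ₅' : θ₅ ≤ θ') (hθ₃' : θ₃ ≤ θ') :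
    ∃ a : ℝ, 0 ≤ a ∧ ∀ (K : ℕ) (t : ℝ), |t| ≤ l₀ →
      URateUpTo K (EAt t) (EBt t) (g K) (fun i => g (K + 1) (i + 1)) (uA K) (uB K) dom
        (a + C₉ * (γ ^ 3 * Cd) * (θ' / (θ' - max ω θc)) + C₅) θ' κ := by
  obtain ⟨a, ha0, harg⟩ := argBracket_tower (δc := fun K => C₃ * θ₃ ^ K) hG hP hC₃ hθ₃ hθ₃1 hθ₃'
    (fun K => by positivity) (fun K => le_rfl)
  have hD : 0 ≤ γ ^ 3 * Cd := mul_nonneg (pow_nonneg (box_nonneg hbox) 3) hCd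
  refine ⟨a, ha0, fun K t ht => ?_⟩
  exact uRateUpTo_tower_anyRate (gB := fun K i => g (K + 1) (i + 1)) (Adm := fun _ => dom)
    (δc := fun K => C₃ * θ₃ ^ K) (h9 t ht) hΛ (hU t ht) (h5 t ht) hω hθc hθ₅ (hθ₃.trans hθ₃') hC₅ hD ha0 hθ' hθ₅' le_rfl
    hgA hgB (fun K i hi => couplingRate_pair_of_injectedDisc hinj hbox K i hi) hclose (fun K j hj => (hG K j hj).1) harg K

/-- The produced constant is `≥ 0` (`C₉ ≥ 0` is read off `FadingMemory` at `k = i = 0`; `γ ≥ 0` off the box). [folklore] -/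
theorem cr_nonneg {C₅ C₉ ω θc Cd γ θ' a : ℝ} {Λ : ℕ → ℕ → ℝ} {g : ℕ → ℕ → ℝ} (hΛ : FadingMemory C₉ ω Λ) (hω : 0 ≤ ω)
    (hCd : 0 ≤ Cd) (hbox : ∀ K i, i ≤ K → 0 < g K i ∧ g K i ≤ γ) (hC₅ : 0 ≤ C₅) (ha : 0 ≤ a) (hθ' : max ω θc < θ') :
    0 ≤ a + C₉ * (γ ^ 3 * Cd) * (θ' / (θ' - max ω θc)) + C₅ := by
  have hC₉ : 0 ≤ C₉ := by
    have h := hΛ 0 0 le_rfl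
    have : Λ 0 0 ≤ C₉ := by simpa using h.2
    exact h.1.trans this
  have hγ : 0 ≤ γ := box_nonneg hbox
  have hm : 0 ≤ max ω θc := le_max_of_le_left hω
  have hθ'0 : 0 < θ' := lt_of_le_of_lt hm hθ'
  have hden : 0 < θ' - max ω θc := sub_pos.mpr hθ'
  positivity

end AnyCarrier

/-! ## §2 On NODE O's carrier: the family tower AND the END's (F′) from ONE selection, minimal bill -/

section Background

variable {n : Type} [Fintype n] [DecidableEq n] [Nonempty n]

/-- **NODE T FOR THE `t`-FAMILY AND THE END's (F′), ON `occCarriers`, FROM ONE SELECTION** — hypotheses: the gen-55 minimal bill of the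
background coordinate (NE3's covariant root amendment 4 with ANY real `C, Λ₁, Λ₂′`; NE3's (H∃) `hmin`; `0 ≤ b ≤ ε`, `512·5·8·L²·b ≤ 1`,
`16·C₀·ε ≤ 3`, `2·twoLevelSmall 4 L·ε ≤ L²`, `gradConst 4 c ≤ g`; `hdom`; the sector condition; a reference datum `v₁ ∈ dom`), node U3's shapes for
every member `|t| ≤ l₀` of the family `EAᵗ`, `EBᵗ` on the carrier (t-uniform data), node U2's `InjectedRate`, ANY common rate `θ′ ≥ θ = L^{−1∕6}`.
CONCLUSION: `uA uB oneA oneB`, ONE `a ≥ 0`, `hURt` for every cutoff and member (= `wRates_of_uRateUpTo_family`'s input) AND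
`∀ K, ∃ v₁ ∈ dom, uA K v₁ = oneA ∧ uB K v₁ = oneB` (= the END's `hwit`). [folklore] -/
theorem uRateUpTo_family_hwit_occCarriers_of_hmin_ref {L N : ℕ} (hL : 2 ≤ L) (hN : 1 ≤ N) {θ : ℝ} (hθ : 0 < θ)
    (hθ6 : θ ^ 6 = ((L : ℝ))⁻¹) {ε b c : ℝ} (hb : 0 ≤ b) (hbε : b ≤ ε)
    (hbs : 512 * (4 + 1) * (4 + 4) * (L : ℝ) ^ 2 * b ≤ 1)
    (hε1 : 16 * C0 4 * ε ≤ 3) (h2line : 2 * twoLevelSmall 4 L * ε ≤ (L : ℝ) ^ 2)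
    {g C Λ₁ Λ₂' : ℝ} (hgc : gradConst 4 c ≤ g)
    {dom : Set (Site 4 → Fin 4 → (Matrix n n ℂ)ˣ)}
    (hdom : ∀ v ∈ dom, ∀ w : Site 4 → (Matrix n n ℂ)ˣ, IsUnitarySite w → IsPeriodicSite w (N : ℤ) → gaugeAct w v ∈ dom)
    (hmin : ∀ V ∈ dom, ∀ k : ℕ, ∃ U, IsMinimiser 4 (sfClass 4 L N ε) L N k V U ∧ RegularSup 4 L N b c k U)
    (h : ∀ k : ℕ, 1 ≤ k → ∀ V ∈ dom, ∀ UA UB : Site 4 → Fin 4 → (Matrix n n ℂ)ˣ,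
      IsMinimiser 4 (sfClass 4 L N ε) L N k V UA → IsMinimiser 4 (sfClass 4 L N ε) L N (k + 1) V UB →
        Regular 4 L N b g (k + 1) UB →
        ∃ (u : Site 4 → (Matrix n n ℂ)ˣ) (Z : Site 4 → Fin 4 → Matrix n n ℂ),
          IsUnitarySite u ∧ IsPeriodicSite u ((N * L ^ k : ℕ) : ℤ) ∧
          IsSkewDir Z ∧ IsPeriodicDir Z ((N * L ^ k : ℕ) : ℤ) ∧
          gaugeAct u UA = vary (rescale L (bavg L UB)) Z 1 ∧
          energyNormW L k (rescale L (bavg L UB)) Z (periodBox (N * L ^ k)) ≤ C * residualScale 4 L N b g k ∧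
          (∀ (κ : Fin 4) (x : Site 4) (μ : Fin 4),
            ‖Ad (rescale L (bavg L UB) (x + e κ) μ) (Z (x + e μ) κ) - Z x κ‖ ≤ Λ₁ * (((L : ℝ)⁻¹) ^ k) ^ 2) ∧
          (∀ (κ μ : Fin 4) (y : Site 4),
            ‖Ad (rescale L (bavg L UB) (y + e κ) μ)
                (Ad (rescale L (bavg L UB) (y + e κ + e μ) μ) (Z (y + (2 : ℕ) • e μ) κ) - Z (y + e μ) κ)
              - (Ad (rescale L (bavg L UB) (y + e κ) μ) (Z (y + e μ) κ) - Z y κ)‖ ≤ Λ₂' * (((L : ℝ)⁻¹) ^ k) ^ 3))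
    (hsector : (Fintype.card n : ℝ) * (N : ℝ) ^ 2 * ε ≤ sectorConst n)
    {v₁ : Site 4 → Fin 4 → (Matrix n n ℂ)ˣ} (hv₁ : v₁ ∈ dom)
    (D : Type) (sc : D → ℕ) (dl : D → ℝ) (hdl : ∀ X, 0 ≤ dl X)
    -- node U3's shapes for the `t`-family on the carrier, node U2's output, the window, the common rate
    {W : Set (ℕ → ℝ)} {l₀ : ℝ}
    {EAt : ℝ → Functional (occCarriers n L N ε dom D sc dl hdl) (occCarriers n L N ε dom D sc dl hdl).BgA}
    {EBt : ℝ → Functional (occCarriers n L N ε dom D sc dl hdl) (occCarriers n L N ε dom D sc dl hdl).BgB}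
    {κ θ₅ C₅ C₉ ω θc Cd γg P θ' : ℝ} {q : ℕ} {Λ : ℕ → ℕ → ℝ} {CU : (ℕ → ℝ) → ℕ → ℝ} {gtab : ℕ → ℕ → ℝ}
    (h9 : ∀ t : ℝ, |t| ≤ l₀ → NE9 (EAt t) W κ Λ) (hΛ : FadingMemory C₉ ω Λ) (hω : 0 ≤ ω)
    (hU : ∀ t : ℝ, |t| ≤ l₀ → LipBackground (EAt t) W κ CU) (hG : PolyLipGrowth CU gtab P q) (hP : 0 ≤ P)
    (h5 : ∀ t : ℝ, |t| ≤ l₀ → NE5 (EAt t) (EBt t) W κ θ₅ C₅) (hθ₅ : 0 ≤ θ₅) (hC₅ : 0 ≤ C₅)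
    (hinj : InjectedRate Cd 0 θc (fun K j => T4CouplingMatching.disc (gtab K) (gtab (K + 1)) j)) (hCd : 0 ≤ Cd)
    (hθc : 0 ≤ θc) (hbox : ∀ K i, i ≤ K → 0 < gtab K i ∧ gtab K i ≤ γg)
    (hgA : ∀ K, gtab K ∈ W) (hgB : ∀ K, (fun i => gtab (K + 1) (i + 1)) ∈ W)
    (hθ' : max ω θc < θ') (hθ₅' : θ₅ ≤ θ') (hθθ' : θ ≤ θ') :
    ∃ (uA : ℕ → (Site 4 → Fin 4 → (Matrix n n ℂ)ˣ) → (occCarriers n L N ε dom D sc dl hdl).BgA)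
      (uB : ℕ → (Site 4 → Fin 4 → (Matrix n n ℂ)ˣ) → (occCarriers n L N ε dom D sc dl hdl).BgB)
      (oneA : (occCarriers n L N ε dom D sc dl hdl).BgA) (oneB : (occCarriers n L N ε dom D sc dl hdl).BgB) (a : ℝ),
      0 ≤ a ∧
      (∀ (K : ℕ) (t : ℝ), |t| ≤ l₀ → URateUpTo K (EAt t) (EBt t) (gtab K) (fun i => gtab (K + 1) (i + 1)) (uA K) (uB K) dom
        (a + C₉ * (γg ^ 3 * Cd) * (θ' / (θ' - max ω θc)) + C₅) θ' κ) ∧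
      (∀ K : ℕ, ∃ v₁ ∈ dom, uA K v₁ = oneA ∧ uB K v₁ = oneB) := by
  obtain ⟨uA, uB, oneA, oneB, C₃, hC₃, hclose, hwit⟩ := hwit_of_hmin_ref hL hN hθ hθ6 hb hbε hbs hε1 h2line hgc hdom hmin h
    hsector hv₁ D sc dl hdl
  obtain ⟨a, ha, hrate⟩ := uRateUpTo_of_hclose_family h9 hΛ hω hU hG hP h5 hθ₅ hC₅ hclose hC₃ hθ.le
    (theta_lt_one hL hθ hθ6) hinj hCd hθc hbox hgA hgB hθ' hθ₅' hθθ'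
  exact ⟨uA, uB, oneA, oneB, a, ha, hrate, hwit⟩

/-! ## §3 The END's residual-witness rate binders AND (F′) PRODUCED on `occCarriers` -/

/-- **THE END's (W-rate-t), (W-rate-0) (term ledger), (W-rate-0) (reference ledger) AND (F′) ON `occCarriers`, FROM ONE SELECTION** —
§2 ∘ `TermwiseResidualWitnessTower.wRates_of_uRateUpTo_family` for the field-independent step constants `vc· K t X := E·ᵗ (g· K) one· X`
(the values of the `t`-family at the reference backgrounds), `CrW := 2·Cr`, `Cr := a + C₉(γg³Cd)θ′∕(θ′ − max(ω,θc)) + C₅`: hypotheses = §2's +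
`0 ≤ l₀` + the ledgers' scale bounds (W-sc) on `wfac`, `nf`, `wfac₀` (X-A2's objects, abstract).  The four conclusions are VERBATIM the END
binders `hWratet`, `hWrate0`, `hWrate0'` (up to the names of the constants) and `hwit` of `goodClause_summable_UN_levels_of_thm1At_residualW`.
HONEST: every analytic input is a HYPOTHESIS; the functionals and ledgers are ABSTRACT; nothing of NE3∕NE5∕NE9∕NE7 discharged. [folklore] -/
theorem wRates_hwit_occCarriers_of_hmin_ref {L N : ℕ} (hL : 2 ≤ L) (hN : 1 ≤ N) {θ : ℝ} (hθ : 0 < θ)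
    (hθ6 : θ ^ 6 = ((L : ℝ))⁻¹) {ε b c : ℝ} (hb : 0 ≤ b) (hbε : b ≤ ε)
    (hbs : 512 * (4 + 1) * (4 + 4) * (L : ℝ) ^ 2 * b ≤ 1)
    (hε1 : 16 * C0 4 * ε ≤ 3) (h2line : 2 * twoLevelSmall 4 L * ε ≤ (L : ℝ) ^ 2)
    {g C Λ₁ Λ₂' : ℝ} (hgc : gradConst 4 c ≤ g)
    {dom : Set (Site 4 → Fin 4 → (Matrix n n ℂ)ˣ)}
    (hdom : ∀ v ∈ dom, ∀ w : Site 4 → (Matrix n n ℂ)ˣ, IsUnitarySite w → IsPeriodicSite w (N : ℤ) → gaugeAct w v ∈ dom)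
    (hmin : ∀ V ∈ dom, ∀ k : ℕ, ∃ U, IsMinimiser 4 (sfClass 4 L N ε) L N k V U ∧ RegularSup 4 L N b c k U)
    (h : ∀ k : ℕ, 1 ≤ k → ∀ V ∈ dom, ∀ UA UB : Site 4 → Fin 4 → (Matrix n n ℂ)ˣ,
      IsMinimiser 4 (sfClass 4 L N ε) L N k V UA → IsMinimiser 4 (sfClass 4 L N ε) L N (k + 1) V UB →
        Regular 4 L N b g (k + 1) UB →
        ∃ (u : Site 4 → (Matrix n n ℂ)ˣ) (Z : Site 4 → Fin 4 → Matrix n n ℂ),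
          IsUnitarySite u ∧ IsPeriodicSite u ((N * L ^ k : ℕ) : ℤ) ∧
          IsSkewDir Z ∧ IsPeriodicDir Z ((N * L ^ k : ℕ) : ℤ) ∧
          gaugeAct u UA = vary (rescale L (bavg L UB)) Z 1 ∧
          energyNormW L k (rescale L (bavg L UB)) Z (periodBox (N * L ^ k)) ≤ C * residualScale 4 L N b g k ∧
          (∀ (κ : Fin 4) (x : Site 4) (μ : Fin 4),
            ‖Ad (rescale L (bavg L UB) (x + e κ) μ) (Z (x + e μ) κ) - Z x κ‖ ≤ Λ₁ * (((L : ℝ)⁻¹) ^ k) ^ 2) ∧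
          (∀ (κ μ : Fin 4) (y : Site 4),
            ‖Ad (rescale L (bavg L UB) (y + e κ) μ)
                (Ad (rescale L (bavg L UB) (y + e κ + e μ) μ) (Z (y + (2 : ℕ) • e μ) κ) - Z (y + e μ) κ)
              - (Ad (rescale L (bavg L UB) (y + e κ) μ) (Z (y + e μ) κ) - Z y κ)‖ ≤ Λ₂' * (((L : ℝ)⁻¹) ^ k) ^ 3))
    (hsector : (Fintype.card n : ℝ) * (N : ℝ) ^ 2 * ε ≤ sectorConst n)
    {v₁ : Site 4 → Fin 4 → (Matrix n n ℂ)ˣ} (hv₁ : v₁ ∈ dom)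
    (D : Type) (sc : D → ℕ) (dl : D → ℝ) (hdl : ∀ X, 0 ≤ dl X)
    {W : Set (ℕ → ℝ)} {l₀ : ℝ} (hl₀ : 0 ≤ l₀)
    {EAt : ℝ → Functional (occCarriers n L N ε dom D sc dl hdl) (occCarriers n L N ε dom D sc dl hdl).BgA}
    {EBt : ℝ → Functional (occCarriers n L N ε dom D sc dl hdl) (occCarriers n L N ε dom D sc dl hdl).BgB}
    {κ θ₅ C₅ C₉ ω θc Cd γg P θ' : ℝ} {q : ℕ} {Λ : ℕ → ℕ → ℝ} {CU : (ℕ → ℝ) → ℕ → ℝ} {gtab : ℕ → ℕ → ℝ}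
    (h9 : ∀ t : ℝ, |t| ≤ l₀ → NE9 (EAt t) W κ Λ) (hΛ : FadingMemory C₉ ω Λ) (hω : 0 ≤ ω)
    (hU : ∀ t : ℝ, |t| ≤ l₀ → LipBackground (EAt t) W κ CU) (hG : PolyLipGrowth CU gtab P q) (hP : 0 ≤ P)
    (h5 : ∀ t : ℝ, |t| ≤ l₀ → NE5 (EAt t) (EBt t) W κ θ₅ C₅) (hθ₅ : 0 ≤ θ₅) (hC₅ : 0 ≤ C₅)
    (hinj : InjectedRate Cd 0 θc (fun K j => T4CouplingMatching.disc (gtab K) (gtab (K + 1)) j)) (hCd : 0 ≤ Cd)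
    (hθc : 0 ≤ θc) (hbox : ∀ K i, i ≤ K → 0 < gtab K i ∧ gtab K i ≤ γg)
    (hgA : ∀ K, gtab K ∈ W) (hgB : ∀ K, (fun i => gtab (K + 1) (i + 1)) ∈ W)
    (hθ' : max ω θc < θ') (hθ₅' : θ₅ ≤ θ') (hθθ' : θ ≤ θ')
    -- the ledgers of the residual-proper factor and their scale bounds (W-sc), abstract (X-A2)
    {σ : Type*} [DecidableEq σ] {T : ℕ → Finset σ} {Bad : ℕ → ℝ → Finset σ}
    (wfac nf : ℕ → ℝ → σ → Finset D) (wfac₀ : ℕ → Finset D)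
    (hsc : ∀ K t, |t| ≤ l₀ → ∀ τ ∈ T K \ Bad K t, ∀ X ∈ wfac K t τ, sc X ≤ K)
    (hscF : ∀ K t, |t| ≤ l₀ → ∀ τ ∈ T K \ Bad K t, ∀ X ∈ nf K t τ, sc X ≤ K)
    (hsc₀ : ∀ K, ∀ X ∈ wfac₀ K, sc X ≤ K) :
    ∃ (uA : ℕ → (Site 4 → Fin 4 → (Matrix n n ℂ)ˣ) → (occCarriers n L N ε dom D sc dl hdl).BgA)
      (uB : ℕ → (Site 4 → Fin 4 → (Matrix n n ℂ)ˣ) → (occCarriers n L N ε dom D sc dl hdl).BgB)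
      (oneA : (occCarriers n L N ε dom D sc dl hdl).BgA) (oneB : (occCarriers n L N ε dom D sc dl hdl).BgB) (Cr : ℝ),
      0 ≤ Cr ∧
      (∀ K t, |t| ≤ l₀ → ∀ τ ∈ T K \ Bad K t, ∀ X ∈ wfac K t τ, X ∈ nf K t τ →
        |(EBt t (fun i => gtab (K + 1) (i + 1)) oneB X - EBt 0 (fun i => gtab (K + 1) (i + 1)) oneB X)
            - (EAt t (gtab K) oneA X - EAt 0 (gtab K) oneA X)|
          ≤ 2 * Cr * θ' ^ sc X * Real.exp (-(κ * dl X))) ∧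
      (∀ K t, |t| ≤ l₀ → ∀ τ ∈ T K \ Bad K t, ∀ X ∈ wfac K t τ,
        |EBt 0 (fun i => gtab (K + 1) (i + 1)) oneB X - EAt 0 (gtab K) oneA X| ≤ 2 * Cr * θ' ^ sc X * Real.exp (-(κ * dl X))) ∧
      (∀ K, ∀ X ∈ wfac₀ K,
        |EBt 0 (fun i => gtab (K + 1) (i + 1)) oneB X - EAt 0 (gtab K) oneA X| ≤ 2 * Cr * θ' ^ sc X * Real.exp (-(κ * dl X))) ∧
      (∀ K : ℕ, ∃ v₁ ∈ dom, uA K v₁ = oneA ∧ uB K v₁ = oneB) := by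
  obtain ⟨uA, uB, oneA, oneB, a, ha, hrate, hwit⟩ := uRateUpTo_family_hwit_occCarriers_of_hmin_ref hL hN hθ hθ6 hb hbε hbs hε1
    h2line hgc hdom hmin h hsector hv₁ D sc dl hdl h9 hΛ hω hU hG hP h5 hθ₅ hC₅ hinj hCd hθc hbox hgA hgB hθ' hθ₅' hθθ'
  have hCr := cr_nonneg hΛ hω hCd hbox hC₅ ha hθ'
  have hθ'0 : 0 ≤ θ' := (le_max_of_le_left hω).trans hθ'.le
  obtain ⟨h1, h2, h3⟩ := wRates_of_uRateUpTo_family (C := occCarriers n L N ε dom D sc dl hdl) (T := T) (Bad := Bad) EAt EBt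
    gtab (fun K i => gtab (K + 1) (i + 1)) uA uB oneA oneB wfac nf wfac₀ hCr hθ'0 hl₀ hrate hwit hsc hscF hsc₀
  exact ⟨uA, uB, oneA, oneB, _, hCr, h1, h2, h3, hwit⟩

end Background

end

end Summit.QuantumFields.BalabanUV.T4Continuum.NE7EtaBackgroundFamilyDocking
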